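import Literature.NumberTheory.Automorphic.Liu2021.Thm418AsPrinted
import HarnessLib

/-!
# [Liu 2021, Thm 4.18 (3)] at dictionary level: `ε` is RIGID under Galois twist of the adèlic oscillator representations
# `ω(μ,ε,χ)` by `σ ∈ Gal(ℂ/M_μ)`

Topic `NumberTheory/Automorphic/Liu2021`; namespace `Literature.NumberTheory.Automorphic.Liu2021` (sub-namespace `Thm418Data`, the datum of
[Liu 2021, Thm 4.18], `Thm418AsPrinted.lean`).  Interface row III-11 (G2) «EPS-RIGIDITY UNDER GALOIS TWIST» of the cell `hodgecm-mathlib`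
(director g1 RULING 2026-08-28T02:56:13Z «(G2) = ROW»; discovered by A-p19, MILESTONE-0 02:49:58Z, as an unstated printed input of
[Liu 2021, Thm 4.18 (3)]; Lean text = A-p19's `A-provers/A-p19/EpsRigidUnderGaloisTwistText.lean` sha16 568dd5f267e556ed, body VERBATIM);
consumer = stub G `stub_mainGaloisGlue` of `Lines/a3-liu418.lean` (binder `hLiu418` = [Liu 2021, Thm 4.18]) through A-p19's closing theorem
`stub_mainGaloisGlue_of (h21) (hGT : ∀ <face prefix>, Thm418Data.EpsRigidUnderGaloisTwist D₀)`, `D₀ := toThm418Data ℭ_V ((muConj 𝕌_V).rest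
(restTailOne …))` (the face instantiation stays A-side).  ONE NAMED FACT `Thm418Data.EpsRigidUnderGaloisTwist` (D-0014: a `def … : Prop`
with the datum as parameter, never asserted; net Literature debt of this file: +1) and NOTHING ELSE (statement-only file; the case
`σ = 1` — a `ℂ`-linear `𝔾`-isomorphism `D.AreIsomorphic i j` is `σ`-semilinear for `σ = AlgEquiv.refl`, so the predicate gives `i.ε = j.ε`,
weaker than item (2) — is left to consumers).  HC_CM is proved only modulo the 7 printed citations until rung 0 closes; this file
discharges none of them.

## The printed text (Y. Liu, Camb. J. Math. 9 (2021) = arXiv:2102.11518, `FJcycle.tex` md5 6db49a74122d; print pp. 52–54)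

**THEOREM 4.18 (3)** (l. 2243, print p. 52), VERBATIM: «For every given `ε` that is `μ`-admissible, the subspace `⊕_χ ω(μ,ε,χ)` is stable
under the action of `Gal(ℂ/M_μ)`.»  (Standing data l. 2053–2074 and Def. 4.16: `n ≥ 2`, `𝕍` totally positive definite incoherent of
rank `n`, `𝔾 = U(𝕍)`, `μ` a conjugate symplectic character of weight one, `M_μ ⊆ ℂ` its field of values (l. 1928); `Gal(ℂ/M_μ)` acts on
`Ω(μ) ⊗_{M_μ} ℂ` through the second factor, `σ`-semilinearly and commuting with `𝔾(𝔸_F^∞)`.)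

**ITS PROOF** (l. 2272–2289, print p. 53 – p. 54), VERBATIM (first paragraph; the case analysis is summarised): «Now we consider statement
(3). Since `Gal(ℂ/M_μ)` stabilizes `μ` and by (2), it suffices to show that for every rational prime `p`, the image of `Gal(ℂ/M_μ)` under the
`p`-adic cyclotomic character `χ_p : Gal(ℂ/ℚ) → ℤ_p^×` is contained in `ℤ_p^× ∩ Nm_{E_𝔭/F_𝔭} E_𝔭^×` for every prime `𝔭` of `F` above `p`.
This only becomes a problem if `𝔭` is ramified in `E`. […] Put `U_{E/F} := ℤ_p^× ∩ Nm_{E/F} E^×`, which we may assume a subgroup of `ℤ_p^×`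
of index `2`. Denote by `M_{E/F} ⊆ ℂ` the subfield corresponding to the kernel of the composite homomorphism
`Gal(ℂ/ℚ) → ℤ_p^× → ℤ_p^×/U_{E/F}`, which is a quadratic field. Thus, our goal is to show that `M_{E/F}` is contained in `M_μ`.»  Then:
`p` odd (l. 2274–2279: `E = F(√u)`, `μ(√u)² = μ(−1)`, `μ^{alg}(√u) = ± p^{f/2}` resp. `± √−1 p^{f/2}` with `f` odd ⇒ `√p` resp. `√−p ∈ M_μ`);
`p = 2` (l. 2281–2288: Eisenstein polynomial `X² + aX + b`, `d := min{2 v_F(a) − 1, v_F(4)}`, three cases `M_{E/F} = ℚ(√−1), ℚ(√2),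
ℚ(√−2)`, using «[BH06, Proposition 41.2 (2)]» twice).  «Statement (3) is proved.» (l. 2289).

## The typing («dictionary level», as rows III-9′ `Thm415Pinned` and B3-12 `oscillatorTriple_dictionary`)

WHAT THE PROOF ESTABLISHES, read at the level of the modules `ω(μ,ε,χ)` themselves (A-p19's finding 02:49:58Z): for `σ ∈ Gal(ℂ/M_μ)`
the `σ`-twist `ω(μ,ε,χ)^σ := ℂ ⊗_{ℂ,σ} ω(μ,ε,χ)` of an admissible summand is again a summand `ω(μ,ε′,χ′)` WITH THE SAME COLLECTION
`ε′ = ε` (Galois twist of the local Weil representations moves the class `ε_v ∈ E_v^{−×}/Nm E_v^×` by the cyclotomic class `χ_{cyc,p}(σ)` —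
this is where «`Gal(ℂ/M_μ)` stabilizes `μ`» and [BH06 §41.2 (2)] enter — and the displayed norm containment says that class is trivial;
[Lem. D.1 (3)] separates collections).  TYPED AS RIGIDITY: **a `σ`-SEMILINEAR `𝔾(𝔸_F^∞)`-equivariant bijection `ω_i → ω_j` between
admissible summands (= an isomorphism of `ℂ[𝔾]`-modules `ω_i^σ ≅ ω_j`) forces `i.ε = j.ε`** — the predicate
`Thm418Data.EpsRigidUnderGaloisTwist D` on the datum `D` of Thm 4.18 (`D.AdmIndex` = the `μ`-admissible `(ε,χ)`, Def. 4.12;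
`D.omegaAt`, `D.rhoAt` = `ω(μ,ε,χ)` with its `𝔾(𝔸_F^∞)`-action, Def. 4.11; `M_μ = fieldOfValues E D.μ`, l. 1928; weight one and conjugate
symplectic are FIELDS of `D`, Def. 4.16).  With it, item (3) follows from the main isomorphism by Schur's lemma for semilinear
intertwiners (irreducibility = [Def 4.11], binder `h411`) — A-p19's route for stub G.
READINGS. (R1) `Gal(ℂ/M_μ)` = `ℂ ≃ₐ[fieldOfValues E D.μ] ℂ` (all automorphisms of `ℂ` over `M_μ`, as printed; no topology).
(R2) «isomorphism of `ℂ[𝔾]`-modules `ω_i^σ ≅ ω_j`» = a bijective `f : ω_i →ₛₗ[σ] ω_j` with `f (g·w) = g·(f w)`.  (R3) The conclusion is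
`i.ε = j.ε` only (NOT `χ′ = χ^σ`: the printed item (3) is about the `ε`-blocks `⊕_χ`).  (R4) No hypothesis beyond the datum (`n ≥ 2`,
weight one, conjugate symplectic are in `D`; no `n ≥ 3`).
WEAKER/STRONGER-THAN-PRINT: the sentence quantifies over abstract `σ`-semilinear isomorphisms between the summands rather than over the
one induced by `σ ⊗ 1` on `Ω(μ) ⊗_{M_μ} ℂ` — this is what the printed PROOF shows (it never mentions `Ω(μ)`: l. 2272 reduces (3) to a
statement about `μ`, `χ_p` and the local norm groups), and it is the form stub G consumes.  It is a PREDICATE on the datum: a consumer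
takes `(h : D.EpsRigidUnderGaloisTwist)` for ITS OWN `D` (Liu's `ω(μ,ε,χ) = ⊗'_v ω(μ_v,ε_v,χ_v)` of Def. 4.11 — for the cell, `D₀` above);
`∀ D, D.EpsRigidUnderGaloisTwist` is not the theorem (false for bare carriers) and is not claimed.  NO PROOF (fan B; the local
computation and [BH06] are absent from the tree: `lean search 'Bushnell'` = 0 declarations, 2026-08-28).

SOURCE STATUS. [Liu2021] HELD (TeX of record, lines quoted above).  [BushnellHenniart2006] = C. J. Bushnell, G. Henniart, *The local
Langlands conjecture for GL(2)*, Grundlehren 335, Springer (2006), Prop. 41.2 (2) — NOT HELD (`lit books --grep Bushnell`: none, 2026-08-28);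
locator «as cited by Liu l. 2283, 2285», UNVERIFIED against the book (flagged like [MR92] in row III-8); chapter located by the cell's literature seat
(lit1, card `shelf/BH06-Prop41_2-DyadicNormGroups.md`, 2026-08-28): §41 = first section of Ch. 10 «Arithmetic of Dyadic Fields», printed pp. 251–266; held
substitutes for the dyadic norm-group facts Liu takes from it: Serre, *Local Fields*, Ch. V §2 Prop. 3 + Cor. (pp. 82–83), §3 Cor. 3, Cor. 7, Remark (pp. 85–87);
O'Meara, *Introduction to Quadratic Forms*, §63 (63:3, 63:4, 63:9–63:16).
CAUTION FOR A FUTURE PROOF (lit1's finite check, same card §5 — recorded, not adjudicated here): Liu's case-1 sentence l. 2283 («If `d = v_F(4)`, then by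
[BH06, Prop. 41.2 (2)], `3` is contained in `Nm_{E/F} E^×`, which is a contradiction. Thus, we have `d < v_F(4)`. Then we can find `u ∈ O_F^×` such that
`E = F(√u)`») cannot hold as printed when the residue degree `f(F/ℚ₂)` is EVEN — instance `F = ℚ₂(√5)`, `E = F(√(2√5))`: `d = v_F(4) = 2` while
`ℤ₂^× ∩ Nm_{E/F} E^× = 1 + 4ℤ₂` (`3, −1 ∉ Nm`, `5 ∈ Nm`), i.e. `M_{E/F} = ℚ(√−1)` with `E = F(√ϖ)`, `ϖ` a uniformizer.  The STATEMENT (3) — and hence this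
predicate for Liu's family — appears unaffected (in that instance `μ(√ϖ)² = μ(−1) = −1` and `2^{f/2} ∈ ℚ`, so `√−1 ∈ M_μ` still); a from-scratch proof of the
local lemma should split on the parity of `f` (index `(F^× : Nm) = 2`, unramified symbol, «`d < v_F(4)` ⇔ `E = F(√unit)`»).  §4's standing hypothesis allows any
totally real `F` (l. 1878), so even `f` occurs.

## References
* [Liu2021] Thm. 4.18 (3) l. 2243; proof l. 2272–2289; Def. 4.11–4.12 (l. 2083–2110); Def. 4.16 (l. 2219); §4.1 l. 1928 (`M_μ`);
  App. D Lem. D.1 (3).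
* [BushnellHenniart2006] Prop. 41.2 (2) (as cited by Liu; not held; Ch. 10 §41, pp. 251–266).
* J.-P. Serre, *Local Fields* (GTM 67), Ch. V §2–§3, and O. T. O'Meara, *Introduction to Quadratic Forms*, §63 — held substitutes for the dyadic norm groups.
* Tree: `Thm418Data`, `Thm418Data.AdmIndex ∕ omegaAt ∕ rhoAt ∕ IsAdmissible ∕ AreIsomorphic`, `fieldOfValues` (`Thm418AsPrinted.lean`);
  the cell's instantiation `toThm418Data` (`AppendixC/Glue.lean`), `UniformOmega.rest`, `restTailOne` (`AppendixC/…`).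
-/

noncomputable section

open NumberField

namespace Literature.NumberTheory.Automorphic.Liu2021

namespace Thm418Data

variable {F E : Type} [Field F] [NumberField F] [IsTotallyReal F] [Field E] [NumberField E] [Algebra F E]
  [IsTotallyComplex E] [Algebra.IsQuadraticExtension F E]

/-- **[Liu2021, Thm 4.18 (3)] at dictionary level — `ε`-RIGIDITY UNDER GALOIS TWIST** for the summands of Thm 4.18's datum `D` —
print (l. 2243): «For every given `ε` that is `μ`-admissible, the subspace `⊕_χ ω(μ,ε,χ)` is stable under the action of `Gal(ℂ/M_μ)`»,
whose printed PROOF (l. 2272–2289: «Since `Gal(ℂ/M_μ)` stabilizes `μ` and by (2), it suffices to show that for every rational prime `p`,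
the image of `Gal(ℂ/M_μ)` under the `p`-adic cyclotomic character `χ_p : Gal(ℂ/ℚ) → ℤ_p^×` is contained in `ℤ_p^× ∩ Nm_{E_𝔭/F_𝔭} E_𝔭^×`
for every prime `𝔭` of `F` above `p`» + the local case analysis `p` odd ∕ `p = 2` with [BH06, Prop. 41.2 (2)]) establishes, for the
modules `ω(μ,ε,χ)` themselves: for every `σ ∈ Gal(ℂ/M_μ) = Aut(ℂ/M_μ)` and all `μ`-admissible indices `i = (ε, χ)`, `j = (ε′, χ′)`, a
`σ`-SEMILINEAR `𝔾(𝔸_F^∞)`-equivariant bijection `ω_i → ω_j` (i.e. an isomorphism of `ℂ[𝔾(𝔸_F^∞)]`-modules `ω(μ,ε,χ)^σ ≅ ω(μ,ε′,χ′)`,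
`ω^σ = ℂ ⊗_{ℂ,σ} ω`) forces `ε = ε′` — the Galois twist moves the collection `ε` by the cyclotomic class
`χ_{cyc,p}(σ) ∈ ℤ_p^× ∩ Nm E_𝔭^×` for `σ` fixing `M_μ` (case analysis l. 2274–2288, [BH06 41.2 (2)] at `p = 2`), hence not at all, and
[Lem D.1 (3)] separates collections.  READINGS R1–R4 and the WEAKER/STRONGER-THAN-PRINT note of the module docstring.  Nothing asserted
(a predicate on the datum): a consumer takes `(h : D.EpsRigidUnderGaloisTwist)` for ITS OWN `D`; `∀ D, …` is not claimed.  NO PROOF.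
Lean text = A-p19's (cell hodgecm-mathlib, 2026-08-28T02:58:27Z), verbatim.
[cite: Liu2021, Thm. 4.18 (3) (FJcycle.tex l. 2243) with its proof (l. 2272–2289); App. D Lem. D.1 (3)]
[cite: BushnellHenniart2006, §41.2 Prop. (2) (as cited by Liu l. 2283, 2285; not held)] -/
def EpsRigidUnderGaloisTwist (D : Thm418Data F E) : Prop :=
  ∀ (σ : ℂ ≃ₐ[fieldOfValues E D.μ] ℂ) (i j : D.AdmIndex),
    (∃ f : D.omegaAt i →ₛₗ[(σ : ℂ →+* ℂ)] D.omegaAt j,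
        Function.Bijective f ∧ ∀ (g : D.G) (w : D.omegaAt i), f (D.rhoAt i g w) = D.rhoAt j g (f w)) →
      i.1.1 = j.1.1

end Thm418Data

end Literature.NumberTheory.Automorphic.Liu2021

end
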